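import Summits.AnomalousDissipation.AnomalousDissipation.Theorems.SolenoidalFractalHomogenisationLagrangianStepSidebandXShellEnergy
import Summits.AnomalousDissipation.AnomalousDissipation.Theorems.SolenoidalFractalHomogenisationLagrangianStepSidebandXEnergySplit
import Summits.AnomalousDissipation.AnomalousDissipation.Theorems.SolenoidalFractalHomogenisationLagrangianStepSidebandXSlowEquation
import HarnessLib

/-!
# K1L_D `LagrangianRenormalisationStepDesign` (stmt-AnomalousDissipation-27980), `stub_D1_V0R` (ruling D27-1), brick T8b-3: THE RESIDUAL SUP BOUND
# AND THE WEIGHTED FORCING BUDGET for the single-mode datum (helper; `--kind proof --supports stmt-AnomalousDissipation-27980 --as helper`)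

Summits-side helper file of route `SolenoidalFractalHomogenisation` (prover seat `ad-k1l-cellLawV-w1` g7; 0 sorry, no defs, no named facts).
For the datum `F = Re e_ℓ·p` (`p ⊥ ℓ`, `ℓ ≠ 0`, `2|ℓ| < n`), tensor `(1/n²)•𝔸` (`NearIso 𝔸 lo hi`, `OddSmall 𝔸 β`), `1 ≤ R`, `max|mⱼ|_∞ ≤ Mm ≤ R`,
an a priori bound `‖x s‖ ≤ M` with `‖F‖²_{L²} ≤ M²`, and the smallness `2E_z ξ⁴ ≤ π²lo/4`:
* §1 two exponential integrals;
* §2 **`residualX_norm_le_single`** — `‖r t‖ ≤ e^{−(π²lo/8)t}·ξ·CN·M + M·√ρ₂` on `[0,T]`, where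
  `ρ₂ = (ξ⁴(CN²(E_y + 2E_zξ²) + E_x) + (2/lo)·K_τ·ξ²)/(π²lo/4)` (split energy inequality `…EnergySplit.residualX_norm_sq_le_split` + the
  POINTWISE tail `…ShellEnergy.tailEnergy_le_pointwise`, `K_τ = 4k₀Σ‖α‖²·k₀Σ‖α‖²·64(Σ‖α‖)²/(π²lo²)/(π²lo²R²)` + the initial layer
  `‖r 0‖ ≤ ξ·CN·‖x 0‖`); at `lo ∼ ν`, `R = ⌈ν⁻³⌉`: `√ρ₂ ≲ (ξ/ν)² + (ξ/ν)³ + ξ²/√ν… + ξ`, uniform in `ν` at fixed `ξ/ν`;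
* §3 **`forcing_integral_le_single`** — `∫₀ᵗ e^{−r_lo(t−s)}‖slowForcing s‖ds ≤ ξ·Cf·M·(ξ·CN·min(t, 8/(π²lo)) + (√ρ₂ + 2ξ²CN)·min(t, 1/r_lo))`.
NOT a proof of any registered stub, of K1L_D, or of anomalous dissipation; rung F-D1.A0 infrastructure.
-/

set_option linter.dupNamespace false

noncomputable section

namespace Summit.AnomalousDissipation.AnomalousDissipation.Theorems.SolenoidalFractalHomogenisation.LagrangianStep.Sideband

open Set MeasureTheory Complex UnitAddTorus intervalIntegral
open scoped InnerProductSpace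
open Literature.Analysis Literature.Analysis.FunctionSpaces Literature.Analysis.FunctionSpaces.Torus
open Literature.Analysis.FluidPDE Literature.Analysis.FluidPDE.Torus Literature.Analysis.FluidPDE.LatticeShear
open Summit.AnomalousDissipation.AnomalousDissipation.Theorems.SolenoidalFractalHomogenisation.LagrangianStep.CellChain
  (modeRep continuousOn_modeRep)
open Summit.AnomalousDissipation.AnomalousDissipation.Theorems.SolenoidalFractalHomogenisation.RealisedQuasiStaticCellLaw
  (memLp_two_of_memSobolev_one_complexify memSobolev_one_singleMode)

variable {k₀ : ℕ}

/-! ## §1 Exponential integrals -/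

/-- `∫₀ᵗ e^{-σ (t - s)} ds ≤ min t (1/σ)` (`σ > 0`, `t ≥ 0`). [folklore] -/
theorem integral_exp_neg_sub_le_min' {σ t : ℝ} (hσ : 0 < σ) (ht : 0 ≤ t) :
    ∫ s in (0:ℝ)..t, Real.exp (-(σ * (t - s))) ≤ min t (1 / σ) := by
  refine le_min ?_ (integral_exp_neg_sub_le_inv hσ t)
  have h : ∫ s in (0:ℝ)..t, Real.exp (-(σ * (t - s))) ≤ ∫ _ in (0:ℝ)..t, (1:ℝ) := by
    refine intervalIntegral.integral_mono_on ht
      ((continuous_const.mul (continuous_const.sub continuous_id)).neg.rexp.intervalIntegrable _ _)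
      intervalIntegrable_const fun s hs => ?_
    rw [Real.exp_le_one_iff]; nlinarith [hs.2]
  simpa using h

/-- `∫₀ᵗ e^{-σ s} ds ≤ min t (1/σ)` (`σ > 0`, `t ≥ 0`). [folklore] -/
theorem integral_exp_neg_le_min {σ t : ℝ} (hσ : 0 < σ) (ht : 0 ≤ t) :
    ∫ s in (0:ℝ)..t, Real.exp (-(σ * s)) ≤ min t (1 / σ) := by
  have h := intervalIntegral.integral_comp_sub_left (fun s => Real.exp (-(σ * s))) t (a := 0) (b := t)
  simp only [sub_self, sub_zero] at h
  rw [← h]; exact integral_exp_neg_sub_le_min' hσ ht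

/-! ## §2 The residual sup bound for the single-mode datum -/

/-- Scalar square-root step: `N² ≤ E²a² + M²ρ` with everything nonnegative gives `N ≤ E·a + M·√ρ`. [folklore] -/
theorem sqrt_step_le {N E a M ρ : ℝ} (hN : 0 ≤ N) (hE : 0 ≤ E) (ha : 0 ≤ a) (hM : 0 ≤ M) (hρ : 0 ≤ ρ)
    (h : N ^ 2 ≤ E ^ 2 * a ^ 2 + M ^ 2 * ρ) : N ≤ E * a + M * Real.sqrt ρ := by
  have hs : Real.sqrt ρ ^ 2 = ρ := Real.sq_sqrt hρ
  have hb : 0 ≤ E * a + M * Real.sqrt ρ := by positivity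
  have h2 : N ^ 2 ≤ (E * a + M * Real.sqrt ρ) ^ 2 := by
    nlinarith [h, hs, mul_nonneg (mul_nonneg hE ha) (mul_nonneg hM (Real.sqrt_nonneg ρ))]
  exact (pow_le_pow_iff_left₀ hN hb two_ne_zero).1 h2

/-- Linear combination step (abstract atoms, so that `linarith` never compares large terms). [folklore] -/
theorem combine_le {N2 E r0sq a2 I G σ M2ρ : ℝ} (h1 : N2 ≤ E * r0sq + I) (h2 : E * r0sq ≤ E * a2) (hint : I ≤ G / σ)
    (e : G / σ = M2ρ) : N2 ≤ E * a2 + M2ρ := by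
  linarith

/-- The algebraic identity behind `ρ₂` (abstract atoms, so that `ring` stays cheap). [folklore] -/
theorem rho_identity (ξ M CN Ey Ex Ez lo Kt : ℝ) :
    (ξ ^ 4 * M ^ 2 * (CN ^ 2 * (Ey + 2 * Ez * ξ ^ 2) + Ex) + 2 / lo * (Kt * ξ ^ 2 * M ^ 2)) / (Real.pi ^ 2 * lo / 4) =
      M ^ 2 * ((ξ ^ 4 * (CN ^ 2 * (Ey + 2 * Ez * ξ ^ 2) + Ex) + 2 / lo * (Kt * ξ ^ 2)) / (Real.pi ^ 2 * lo / 4)) := by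
  ring

set_option maxHeartbeats 400000 in
/-- **THE RESIDUAL SUP BOUND** (single-mode datum): `‖r t‖ ≤ e^{−(π²lo/8)t}·ξ·CN·M + M·√ρ₂` on `[0,T]` (`ρ₂` as in the module docstring).
[cite: SandersVerhulstMurdock2007, Lemma 5.2.7 (linear case)] [cite: BedrossianCotiZelati2017, §2] -/
theorem residualX_norm_le_single (W₁ : LatticeWord k₀) {lo hi β : ℝ} (hlo : 0 < lo) (hhi : 0 ≤ hi) (hβ : 0 ≤ β) {n : ℕ} (hn : n ≠ 0)
    {T : ℝ} (hT : 0 < T) {𝔸 : Torus.Visc4 (Fin 3)} (h𝔸 : Torus.NearIso 𝔸 lo hi) (hodd : Torus.OddSmall 𝔸 β)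
    {ℓ : Fin 3 → ℤ} (hℓ0 : ℓ ≠ 0) (hℓ : 2 * Real.sqrt (freqNormSq ℓ) < n) {p : EuclideanSpace ℝ (Fin 3)} (hp : ⟪p, Torus.latticeVec ℓ⟫_ℝ = 0)
    {w : ℝ → UnitAddTorus (Fin 3) → EuclideanSpace ℝ (Fin 3)}
    (h : Torus.IsWeakTensorPassiveVectorOn 0 T ((1 / (n : ℝ) ^ 2) • 𝔸) (W₁.cell n) (fun x => (UnitAddTorus.mFourier ℓ x).re • p) w)
    {R Mm : ℕ} (hR : 1 ≤ R) (hMR : Mm ≤ R) (hM : ∀ j i, |(W₁.phase j).m i| ≤ (Mm : ℤ)) {M : ℝ}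
    (hxM : ∀ s ∈ Icc 0 T, ‖modeRep W₁ n ((1 / (n : ℝ) ^ 2) • 𝔸) (fun x => (UnitAddTorus.mFourier ℓ x).re • p) w ℓ s‖ ≤ M)
    (hE0 : (∫ x, ‖(UnitAddTorus.mFourier ℓ x).re • p‖ ^ 2) ≤ M ^ 2)
    (hsmall : 2 * (12 * (xiCN W₁ lo * xiCf W₁) ^ 2 / (Real.pi ^ 2 * lo)) * (Real.sqrt (freqNormSq ℓ) / n) ^ 4 ≤ Real.pi ^ 2 * lo / 4)
    {t : ℝ} (ht : t ∈ Icc 0 T) :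
    ‖residualX W₁ n ℓ 𝔸 R (fun x => (UnitAddTorus.mFourier ℓ x).re • p) w t‖ ≤
      Real.exp (-(Real.pi ^ 2 * lo / 8 * t)) * ((Real.sqrt (freqNormSq ℓ) / n) * xiCN W₁ lo * M) + M * Real.sqrt (((Real.sqrt (freqNormSq ℓ) / n) ^ 4 * (xiCN W₁ lo ^ 2 * ((32 * Real.pi ^ 2 * 534 ^ 2 * (hi + β / 2) ^ 2 / lo + 24 * (∑ j, 2 * Real.pi * ‖slotAmp W₁ j‖ * (5 + 3 * Real.sqrt (freqNormSq (W₁.phase j).m))) ^ 2 / (Real.pi ^ 2 * lo)) + 2 * (12 * (xiCN W₁ lo * xiCf W₁) ^ 2 / (Real.pi ^ 2 * lo)) * (Real.sqrt (freqNormSq ℓ) / n) ^ 2) + (6 * (∑ j, 4 * Real.pi * ‖slotAmp W₁ j‖ / Real.sqrt (freqNormSq (W₁.phase j).m)) ^ 2 / (Real.pi ^ 2 * lo) + 12 * (xiCN W₁ lo * (4 * Real.pi ^ 2 * (hi + β / 2))) ^ 2 / (Real.pi ^ 2 * lo))) + 2 / lo * ((4 * k₀ * (∑ j, ‖slotAmp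 W₁ j‖ ^ 2) * (k₀ * (∑ j, ‖slotAmp W₁ j‖ ^ 2) * (64 * (∑ j, ‖slotAmp W₁ j‖) ^ 2 / (Real.pi ^ 2 * lo ^ 2)) / (Real.pi ^ 2 * lo ^ 2 * (R : ℝ) ^ 2))) * (Real.sqrt (freqNormSq ℓ) / n) ^ 2)) / (Real.pi ^ 2 * lo / 4)) := by
  have hn0 : (0 : ℝ) < n := by exact_mod_cast Nat.pos_of_ne_zero hn
  have hξ0 : 0 ≤ (Real.sqrt (freqNormSq ℓ) / n) := by positivity
  have hCN0 : 0 ≤ xiCN W₁ lo := xiCN_nonneg W₁ hlo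
  have hM0 : 0 ≤ M := (norm_nonneg _).trans (hxM 0 ⟨le_rfl, hT.le⟩)
  have hE00 : 0 ≤ (∫ x, ‖(UnitAddTorus.mFourier ℓ x).re • p‖ ^ 2) := integral_nonneg fun x => sq_nonneg _
  have hA20 : 0 ≤ (∑ j, ‖slotAmp W₁ j‖ ^ 2) := Finset.sum_nonneg fun j _ => sq_nonneg _
  have hσ0 : 0 < Real.pi ^ 2 * lo / 4 := by positivity
  have hFi : Integrable (fun x => (UnitAddTorus.mFourier ℓ x).re • p) volume :=
    (memLp_two_of_memSobolev_one_complexify (memSobolev_one_singleMode ℓ p)).integrable one_le_two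
  have hbox : ∀ j, (W₁.phase j).m ∈ box R := fun j =>
    mem_box.2 ⟨fun i => by
      have h1 := abs_le.1 (hM j i); have h2 : (Mm : ℤ) ≤ R := (by exact_mod_cast hMR); constructor <;> omega, (W₁.phase j).m_ne⟩
  -- (1) the split Grönwall bound
  have h1 := residualX_norm_sq_le_split W₁ hlo hhi hβ hn h𝔸 hodd h hFi hℓ.le hbox hxM hsmall ht
  -- (2) the pointwise tail
  have hτ : ∀ s ∈ Icc 0 T, tailEnergy W₁ n ℓ 𝔸 R (fun x => (UnitAddTorus.mFourier ℓ x).re • p) w s ≤ (4 * k₀ * (∑ j, ‖slotAmp W₁ j‖ ^ 2) * (k₀ * (∑ j, ‖slotAmp W₁ j‖ ^ 2) * (64 * (∑ j, ‖slotAmp W₁ j‖) ^ 2 / (Real.pi ^ 2 * lo ^ 2)) / (Real.pi ^ 2 * lo ^ 2 * (R : ℝ) ^ 2))) * (Real.sqrt (freqNormSq ℓ) / n) ^ 2 * M ^ 2 := by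
    intro s hs
    calc _ ≤ 4 * k₀ * (∑ j, ‖slotAmp W₁ j‖ ^ 2) * (k₀ * (∑ j, ‖slotAmp W₁ j‖ ^ 2) * (64 * (Real.sqrt (freqNormSq ℓ) / n) ^ 2 * (∫ x, ‖(UnitAddTorus.mFourier ℓ x).re • p‖ ^ 2) * (∑ j, ‖slotAmp W₁ j‖) ^ 2 / (Real.pi ^ 2 * lo ^ 2)) / (Real.pi ^ 2 * lo ^ 2 * (R : ℝ) ^ 2)) := tailEnergy_le_pointwise W₁ hn hT h𝔸 hlo hℓ0 hℓ hp h hR hMR hM hs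
      _ = (4 * k₀ * (∑ j, ‖slotAmp W₁ j‖ ^ 2) * (k₀ * (∑ j, ‖slotAmp W₁ j‖ ^ 2) * (64 * (∑ j, ‖slotAmp W₁ j‖) ^ 2 / (Real.pi ^ 2 * lo ^ 2)) / (Real.pi ^ 2 * lo ^ 2 * (R : ℝ) ^ 2))) * (Real.sqrt (freqNormSq ℓ) / n) ^ 2 * (∫ x, ‖(UnitAddTorus.mFourier ℓ x).re • p‖ ^ 2) := by ring
      _ ≤ (4 * k₀ * (∑ j, ‖slotAmp W₁ j‖ ^ 2) * (k₀ * (∑ j, ‖slotAmp W₁ j‖ ^ 2) * (64 * (∑ j, ‖slotAmp W₁ j‖) ^ 2 / (Real.pi ^ 2 * lo ^ 2)) / (Real.pi ^ 2 * lo ^ 2 * (R : ℝ) ^ 2))) * (Real.sqrt (freqNormSq ℓ) / n) ^ 2 * M ^ 2 := mul_le_mul_of_nonneg_left hE0 (by positivity)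
  -- (3) the Duhamel integral against a constant
  have hcont : ContinuousOn (fun s => Real.exp (-(Real.pi ^ 2 * lo / 4 * (t - s))) * ((Real.sqrt (freqNormSq ℓ) / n) ^ 4 * M ^ 2 * (xiCN W₁ lo ^ 2 * ((32 * Real.pi ^ 2 * 534 ^ 2 * (hi + β / 2) ^ 2 / lo + 24 * (∑ j, 2 * Real.pi * ‖slotAmp W₁ j‖ * (5 + 3 * Real.sqrt (freqNormSq (W₁.phase j).m))) ^ 2 / (Real.pi ^ 2 * lo)) + 2 * (12 * (xiCN W₁ lo * xiCf W₁) ^ 2 / (Real.pi ^ 2 * lo)) * (Real.sqrt (freqNormSq ℓ) / n) ^ 2) + (6 * (∑ j, 4 * Real.pi * ‖slotAmp W₁ j‖ / Real.sqrt (freqNormSq (W₁.phase j).m)) ^ 2 / (Real.pi ^ 2 * lo) + 12 * (xiCN W₁ lo * (4 * Real.pi ^ 2 * (hi + β / 2))) ^ 2 / (Real.pi ^ 2 * lo))) + 2 / lo * tailEnergy W₁ n ℓ 𝔸 R (fun x => (UnitAddTorus.mFourier ℓ x).re • p) w s)) (Icc 0 t) :=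
    ((continuous_const.mul (continuous_const.sub continuous_id)).neg.rexp.continuousOn).mul
      ((continuousOn_const.add (continuousOn_const.mul (continuousOn_tailEnergy W₁ n ℓ 𝔸 R hT.le h))).mono (Icc_subset_Icc_right ht.2))
  have hle : ∀ s ∈ Icc 0 t, Real.exp (-(Real.pi ^ 2 * lo / 4 * (t - s))) * ((Real.sqrt (freqNormSq ℓ) / n) ^ 4 * M ^ 2 * (xiCN W₁ lo ^ 2 * ((32 * Real.pi ^ 2 * 534 ^ 2 * (hi + β / 2) ^ 2 / lo + 24 * (∑ j, 2 * Real.pi * ‖slotAmp W₁ j‖ * (5 + 3 * Real.sqrt (freqNormSq (W₁.phase j).m))) ^ 2 / (Real.pi ^ 2 * lo)) + 2 * (12 * (xiCN W₁ lo * xiCf W₁) ^ 2 / (Real.pi ^ 2 * lo)) * (Real.sqrt (freqNormSq ℓ) / n) ^ 2) + (6 * (∑ j, 4 * Real.pi * ‖slotAmp W₁ j‖ / Real.sqrt (freqNormSq (W₁.phase j).m)) ^ 2 / (Real.pi ^ 2 * lo) + 12 * (xiCN W₁ lo * (4 * Real.pi ^ 2 * (hi + β / 2))) ^ 2 / (Real.pi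 ^ 2 * lo))) + 2 / lo * tailEnergy W₁ n ℓ 𝔸 R (fun x => (UnitAddTorus.mFourier ℓ x).re • p) w s) ≤
      Real.exp (-(Real.pi ^ 2 * lo / 4 * (t - s))) * ((Real.sqrt (freqNormSq ℓ) / n) ^ 4 * M ^ 2 * (xiCN W₁ lo ^ 2 * ((32 * Real.pi ^ 2 * 534 ^ 2 * (hi + β / 2) ^ 2 / lo + 24 * (∑ j, 2 * Real.pi * ‖slotAmp W₁ j‖ * (5 + 3 * Real.sqrt (freqNormSq (W₁.phase j).m))) ^ 2 / (Real.pi ^ 2 * lo)) + 2 * (12 * (xiCN W₁ lo * xiCf W₁) ^ 2 / (Real.pi ^ 2 * lo)) * (Real.sqrt (freqNormSq ℓ) / n) ^ 2) + (6 * (∑ j, 4 * Real.pi * ‖slotAmp W₁ j‖ / Real.sqrt (freqNormSq (W₁.phase j).m)) ^ 2 / (Real.pi ^ 2 * lo) + 12 * (xiCN W₁ lo * (4 * Real.pi ^ 2 * (hi + β / 2))) ^ 2 / (Real.pi ^ 2 * lo))) + 2 / lo * ((4 * k₀ * (∑ j, ‖slotAmp W₁ j‖ ^ 2) * (k₀ *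 (∑ j, ‖slotAmp W₁ j‖ ^ 2) * (64 * (∑ j, ‖slotAmp W₁ j‖) ^ 2 / (Real.pi ^ 2 * lo ^ 2)) / (Real.pi ^ 2 * lo ^ 2 * (R : ℝ) ^ 2))) * (Real.sqrt (freqNormSq ℓ) / n) ^ 2 * M ^ 2)) := by
    intro s hs
    refine mul_le_mul_of_nonneg_left ?_ (Real.exp_pos _).le
    have := mul_le_mul_of_nonneg_left (hτ s ⟨hs.1, hs.2.trans ht.2⟩) (by positivity : (0:ℝ) ≤ 2 / lo)
    linarith
  have hi1 : IntervalIntegrable (fun s => Real.exp (-(Real.pi ^ 2 * lo / 4 * (t - s))) * ((Real.sqrt (freqNormSq ℓ) / n) ^ 4 * M ^ 2 * (xiCN W₁ lo ^ 2 * ((32 * Real.pi ^ 2 * 534 ^ 2 * (hi + β / 2) ^ 2 / lo + 24 * (∑ j, 2 * Real.pi * ‖slotAmp W₁ j‖ * (5 + 3 * Real.sqrt (freqNormSq (W₁.phase j).m))) ^ 2 / (Real.pi ^ 2 * lo)) + 2 * (12 * (xiCN W₁ lo * xiCf W₁) ^ 2 / (Real.pi ^ 2 * lo)) * (Real.sqrt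 (freqNormSq ℓ) / n) ^ 2) + (6 * (∑ j, 4 * Real.pi * ‖slotAmp W₁ j‖ / Real.sqrt (freqNormSq (W₁.phase j).m)) ^ 2 / (Real.pi ^ 2 * lo) + 12 * (xiCN W₁ lo * (4 * Real.pi ^ 2 * (hi + β / 2))) ^ 2 / (Real.pi ^ 2 * lo))) + 2 / lo * tailEnergy W₁ n ℓ 𝔸 R (fun x => (UnitAddTorus.mFourier ℓ x).re • p) w s)) volume 0 t :=
    hcont.intervalIntegrable_of_Icc ht.1
  have hi2 : IntervalIntegrable (fun s => Real.exp (-(Real.pi ^ 2 * lo / 4 * (t - s))) * ((Real.sqrt (freqNormSq ℓ) / n) ^ 4 * M ^ 2 * (xiCN W₁ lo ^ 2 * ((32 * Real.pi ^ 2 * 534 ^ 2 * (hi + β / 2) ^ 2 / lo + 24 * (∑ j, 2 * Real.pi * ‖slotAmp W₁ j‖ * (5 + 3 * Real.sqrt (freqNormSq (W₁.phase j).m))) ^ 2 / (Real.pi ^ 2 * lo)) + 2 * (12 * (xiCN W₁ lo * xiCf W₁) ^ 2 / (Real.pi ^ 2 * lo)) * (Real.sqrt (freqNormSq ℓ) /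 n) ^ 2) + (6 * (∑ j, 4 * Real.pi * ‖slotAmp W₁ j‖ / Real.sqrt (freqNormSq (W₁.phase j).m)) ^ 2 / (Real.pi ^ 2 * lo) + 12 * (xiCN W₁ lo * (4 * Real.pi ^ 2 * (hi + β / 2))) ^ 2 / (Real.pi ^ 2 * lo))) + 2 / lo * ((4 * k₀ * (∑ j, ‖slotAmp W₁ j‖ ^ 2) * (k₀ * (∑ j, ‖slotAmp W₁ j‖ ^ 2) * (64 * (∑ j, ‖slotAmp W₁ j‖) ^ 2 / (Real.pi ^ 2 * lo ^ 2)) / (Real.pi ^ 2 * lo ^ 2 * (R : ℝ) ^ 2))) * (Real.sqrt (freqNormSq ℓ) / n) ^ 2 * M ^ 2))) volume 0 t :=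
    ((continuous_const.mul (continuous_const.sub continuous_id)).neg.rexp.mul continuous_const).intervalIntegrable 0 t
  have hint : ∫ s in (0:ℝ)..t, Real.exp (-(Real.pi ^ 2 * lo / 4 * (t - s))) * ((Real.sqrt (freqNormSq ℓ) / n) ^ 4 * M ^ 2 * (xiCN W₁ lo ^ 2 * ((32 * Real.pi ^ 2 * 534 ^ 2 * (hi + β / 2) ^ 2 / lo + 24 * (∑ j, 2 * Real.pi * ‖slotAmp W₁ j‖ * (5 + 3 * Real.sqrt (freqNormSq (W₁.phase j).m))) ^ 2 / (Real.pi ^ 2 * lo)) + 2 * (12 * (xiCN W₁ lo * xiCf W₁) ^ 2 / (Real.pi ^ 2 * lo)) * (Real.sqrt (freqNormSq ℓ) / n) ^ 2) + (6 * (∑ j, 4 * Real.pi * ‖slotAmp W₁ j‖ / Real.sqrt (freqNormSq (W₁.phase j).m)) ^ 2 / (Real.pi ^ 2 * lo) + 12 * (xiCN W₁ lo * (4 * Real.pi ^ 2 * (hi + β / 2))) ^ 2 / (Real.pi ^ 2 * lo))) + 2 / lo * tailEnergy W₁ n ℓ 𝔸 R (fun x => (UnitAddTorus.mFourier ℓ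 x).re • p) w s) ≤
      ((Real.sqrt (freqNormSq ℓ) / n) ^ 4 * M ^ 2 * (xiCN W₁ lo ^ 2 * ((32 * Real.pi ^ 2 * 534 ^ 2 * (hi + β / 2) ^ 2 / lo + 24 * (∑ j, 2 * Real.pi * ‖slotAmp W₁ j‖ * (5 + 3 * Real.sqrt (freqNormSq (W₁.phase j).m))) ^ 2 / (Real.pi ^ 2 * lo)) + 2 * (12 * (xiCN W₁ lo * xiCf W₁) ^ 2 / (Real.pi ^ 2 * lo)) * (Real.sqrt (freqNormSq ℓ) / n) ^ 2) + (6 * (∑ j, 4 * Real.pi * ‖slotAmp W₁ j‖ / Real.sqrt (freqNormSq (W₁.phase j).m)) ^ 2 / (Real.pi ^ 2 * lo) + 12 * (xiCN W₁ lo * (4 * Real.pi ^ 2 * (hi + β / 2))) ^ 2 / (Real.pi ^ 2 * lo))) + 2 / lo * ((4 * k₀ * (∑ j, ‖slotAmp W₁ j‖ ^ 2) * (k₀ * (∑ j, ‖slotAmp W₁ j‖ ^ 2) * (64 * (∑ j, ‖slotAmp W₁ j‖) ^ 2 / (Real.pi ^ 2 * lo ^ 2)) / (Real.pi ^ 2 *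 lo ^ 2 * (R : ℝ) ^ 2))) * (Real.sqrt (freqNormSq ℓ) / n) ^ 2 * M ^ 2)) / (Real.pi ^ 2 * lo / 4) := by
    have hc0 : 0 ≤ (Real.sqrt (freqNormSq ℓ) / n) ^ 4 * M ^ 2 * (xiCN W₁ lo ^ 2 * ((32 * Real.pi ^ 2 * 534 ^ 2 * (hi + β / 2) ^ 2 / lo + 24 * (∑ j, 2 * Real.pi * ‖slotAmp W₁ j‖ * (5 + 3 * Real.sqrt (freqNormSq (W₁.phase j).m))) ^ 2 / (Real.pi ^ 2 * lo)) + 2 * (12 * (xiCN W₁ lo * xiCf W₁) ^ 2 / (Real.pi ^ 2 * lo)) * (Real.sqrt (freqNormSq ℓ) / n) ^ 2) + (6 * (∑ j, 4 * Real.pi * ‖slotAmp W₁ j‖ / Real.sqrt (freqNormSq (W₁.phase j).m)) ^ 2 / (Real.pi ^ 2 * lo) + 12 * (xiCN W₁ lo * (4 * Real.pi ^ 2 * (hi + β / 2))) ^ 2 / (Real.pi ^ 2 * lo))) + 2 / lo * ((4 * k₀ * (∑ j, ‖slotAmp W₁ j‖ ^ 2) * (k₀ * (∑ j, ‖slotAmp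 W₁ j‖ ^ 2) * (64 * (∑ j, ‖slotAmp W₁ j‖) ^ 2 / (Real.pi ^ 2 * lo ^ 2)) / (Real.pi ^ 2 * lo ^ 2 * (R : ℝ) ^ 2))) * (Real.sqrt (freqNormSq ℓ) / n) ^ 2 * M ^ 2) := by positivity
    calc _ ≤ ∫ s in (0:ℝ)..t, Real.exp (-(Real.pi ^ 2 * lo / 4 * (t - s))) * ((Real.sqrt (freqNormSq ℓ) / n) ^ 4 * M ^ 2 * (xiCN W₁ lo ^ 2 * ((32 * Real.pi ^ 2 * 534 ^ 2 * (hi + β / 2) ^ 2 / lo + 24 * (∑ j, 2 * Real.pi * ‖slotAmp W₁ j‖ * (5 + 3 * Real.sqrt (freqNormSq (W₁.phase j).m))) ^ 2 / (Real.pi ^ 2 * lo)) + 2 * (12 * (xiCN W₁ lo * xiCf W₁) ^ 2 / (Real.pi ^ 2 * lo)) * (Real.sqrt (freqNormSq ℓ) / n) ^ 2) + (6 * (∑ j, 4 * Real.pi * ‖slotAmp W₁ j‖ / Real.sqrt (freqNormSq (W₁.phase j).m)) ^ 2 / (Real.pi ^ 2 * lo) + 12 * (xiCN W₁ lo * (4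 * Real.pi ^ 2 * (hi + β / 2))) ^ 2 / (Real.pi ^ 2 * lo))) + 2 / lo * ((4 * k₀ * (∑ j, ‖slotAmp W₁ j‖ ^ 2) * (k₀ * (∑ j, ‖slotAmp W₁ j‖ ^ 2) * (64 * (∑ j, ‖slotAmp W₁ j‖) ^ 2 / (Real.pi ^ 2 * lo ^ 2)) / (Real.pi ^ 2 * lo ^ 2 * (R : ℝ) ^ 2))) * (Real.sqrt (freqNormSq ℓ) / n) ^ 2 * M ^ 2)) :=
          intervalIntegral.integral_mono_on ht.1 hi1 hi2 hle
      _ = (∫ s in (0:ℝ)..t, Real.exp (-(Real.pi ^ 2 * lo / 4 * (t - s)))) * ((Real.sqrt (freqNormSq ℓ) / n) ^ 4 * M ^ 2 * (xiCN W₁ lo ^ 2 * ((32 * Real.pi ^ 2 * 534 ^ 2 * (hi + β / 2) ^ 2 / lo + 24 * (∑ j, 2 * Real.pi * ‖slotAmp W₁ j‖ * (5 + 3 * Real.sqrt (freqNormSq (W₁.phase j).m))) ^ 2 / (Real.pi ^ 2 * lo)) + 2 * (12 * (xiCN W₁ lo * xiCf W₁) ^ 2 / (Real.pi ^ 2 *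 lo)) * (Real.sqrt (freqNormSq ℓ) / n) ^ 2) + (6 * (∑ j, 4 * Real.pi * ‖slotAmp W₁ j‖ / Real.sqrt (freqNormSq (W₁.phase j).m)) ^ 2 / (Real.pi ^ 2 * lo) + 12 * (xiCN W₁ lo * (4 * Real.pi ^ 2 * (hi + β / 2))) ^ 2 / (Real.pi ^ 2 * lo))) + 2 / lo * ((4 * k₀ * (∑ j, ‖slotAmp W₁ j‖ ^ 2) * (k₀ * (∑ j, ‖slotAmp W₁ j‖ ^ 2) * (64 * (∑ j, ‖slotAmp W₁ j‖) ^ 2 / (Real.pi ^ 2 * lo ^ 2)) / (Real.pi ^ 2 * lo ^ 2 * (R : ℝ) ^ 2))) * (Real.sqrt (freqNormSq ℓ) / n) ^ 2 * M ^ 2)) :=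
          intervalIntegral.integral_mul_const _ _
      _ ≤ 1 / (Real.pi ^ 2 * lo / 4) * ((Real.sqrt (freqNormSq ℓ) / n) ^ 4 * M ^ 2 * (xiCN W₁ lo ^ 2 * ((32 * Real.pi ^ 2 * 534 ^ 2 * (hi + β / 2) ^ 2 / lo + 24 * (∑ j, 2 * Real.pi * ‖slotAmp W₁ j‖ * (5 + 3 * Real.sqrt (freqNormSq (W₁.phase j).m))) ^ 2 / (Real.pi ^ 2 * lo)) + 2 * (12 * (xiCN W₁ lo * xiCf W₁) ^ 2 / (Real.pi ^ 2 * lo)) * (Real.sqrt (freqNormSq ℓ) / n) ^ 2) + (6 * (∑ j, 4 * Real.pi * ‖slotAmp W₁ j‖ / Real.sqrt (freqNormSq (W₁.phase j).m)) ^ 2 / (Real.pi ^ 2 * lo) + 12 * (xiCN W₁ lo * (4 * Real.pi ^ 2 * (hi + β / 2))) ^ 2 / (Real.pi ^ 2 * lo))) + 2 / lo * ((4 * k₀ * (∑ j, ‖slotAmp W₁ j‖ ^ 2) * (k₀ * (∑ j, ‖slotAmp W₁ j‖ ^ 2) * (64 * (∑ j, ‖slotAmp W₁ j‖) ^ 2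 / (Real.pi ^ 2 * lo ^ 2)) / (Real.pi ^ 2 * lo ^ 2 * (R : ℝ) ^ 2))) * (Real.sqrt (freqNormSq ℓ) / n) ^ 2 * M ^ 2)) :=
          mul_le_mul_of_nonneg_right (integral_exp_neg_sub_le_inv hσ0 t) hc0
      _ = _ := by rw [one_div, ← div_eq_inv_mul]
  -- (4) the initial layer
  have hr0 : ‖residualX W₁ n ℓ 𝔸 R (fun x => (UnitAddTorus.mFourier ℓ x).re • p) w 0‖ ≤ (Real.sqrt (freqNormSq ℓ) / n) * xiCN W₁ lo * M := by
    have h0 := norm_residualX_zero_le W₁ hn hℓ h𝔸 hlo R p w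
    rw [← xiCN_def] at h0
    exact h0.trans (mul_le_mul_of_nonneg_left (hxM 0 ⟨le_rfl, hT.le⟩) (by positivity))
  have h2 : Real.exp (-(Real.pi ^ 2 * lo / 4 * t)) * ‖residualX W₁ n ℓ 𝔸 R (fun x => (UnitAddTorus.mFourier ℓ x).re • p) w 0‖ ^ 2 ≤ Real.exp (-(Real.pi ^ 2 * lo / 4 * t)) * ((Real.sqrt (freqNormSq ℓ) / n) * xiCN W₁ lo * M) ^ 2 :=
    mul_le_mul_of_nonneg_left (pow_le_pow_left₀ (norm_nonneg _) hr0 2) (Real.exp_pos _).le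
  -- (5) squares and square roots
  have hρ0 : 0 ≤ (((Real.sqrt (freqNormSq ℓ) / n) ^ 4 * (xiCN W₁ lo ^ 2 * ((32 * Real.pi ^ 2 * 534 ^ 2 * (hi + β / 2) ^ 2 / lo + 24 * (∑ j, 2 * Real.pi * ‖slotAmp W₁ j‖ * (5 + 3 * Real.sqrt (freqNormSq (W₁.phase j).m))) ^ 2 / (Real.pi ^ 2 * lo)) + 2 * (12 * (xiCN W₁ lo * xiCf W₁) ^ 2 / (Real.pi ^ 2 * lo)) * (Real.sqrt (freqNormSq ℓ) / n) ^ 2) + (6 * (∑ j, 4 * Real.pi * ‖slotAmp W₁ j‖ / Real.sqrt (freqNormSq (W₁.phase j).m)) ^ 2 / (Real.pi ^ 2 * lo) + 12 * (xiCN W₁ lo * (4 * Real.pi ^ 2 * (hi + β / 2))) ^ 2 / (Real.pi ^ 2 * lo))) + 2 / lo * ((4 * k₀ * (∑ j, ‖slotAmp W₁ j‖ ^ 2) * (k₀ * (∑ j, ‖slotAmp W₁ j‖ ^ 2) * (64 * (∑ j, ‖slotAmp W₁ j‖) ^ 2 / (Real.pi ^ 2 * lo ^ 2)) / (Real.pi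 ^ 2 * lo ^ 2 * (R : ℝ) ^ 2))) * (Real.sqrt (freqNormSq ℓ) / n) ^ 2)) / (Real.pi ^ 2 * lo / 4)) := by positivity
  have e1 : Real.exp (-(Real.pi ^ 2 * lo / 4 * t)) = Real.exp (-(Real.pi ^ 2 * lo / 8 * t)) ^ 2 := by
    rw [← Real.exp_nat_mul]; congr 1; push_cast; ring
  rw [e1] at h1 h2
  have e := rho_identity (Real.sqrt (freqNormSq ℓ) / n) M (xiCN W₁ lo) (32 * Real.pi ^ 2 * 534 ^ 2 * (hi + β / 2) ^ 2 / lo + 24 * (∑ j, 2 * Real.pi * ‖slotAmp W₁ j‖ * (5 + 3 * Real.sqrt (freqNormSq (W₁.phase j).m))) ^ 2 / (Real.pi ^ 2 * lo)) (6 * (∑ j, 4 * Real.pi * ‖slotAmp W₁ j‖ / Real.sqrt (freqNormSq (W₁.phase j).m)) ^ 2 / (Real.pi ^ 2 * lo) + 12 * (xiCN W₁ lo * (4 * Real.pi ^ 2 * (hi + β / 2))) ^ 2 / (Real.pi ^ 2 * lo)) (12 * (xiCN W₁ lo * xiCf W₁) ^ 2 / (Real.pi ^ 2 * lo)) lo (4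 * k₀ * (∑ j, ‖slotAmp W₁ j‖ ^ 2) * (k₀ * (∑ j, ‖slotAmp W₁ j‖ ^ 2) * (64 * (∑ j, ‖slotAmp W₁ j‖) ^ 2 / (Real.pi ^ 2 * lo ^ 2)) / (Real.pi ^ 2 * lo ^ 2 * (R : ℝ) ^ 2)))
  have hsq := combine_le h1 h2 hint e
  exact sqrt_step_le (norm_nonneg _) (Real.exp_pos _).le (mul_nonneg (mul_nonneg hξ0 hCN0) hM0) hM0 hρ0 hsq

/-! ## §3 The weighted forcing budget -/

/-- Pointwise scalar step of the forcing budget (abstract atoms). [folklore] -/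
theorem budget_pointwise {ω sf nr ny e8 ξ Cf CN M S : ℝ} (hω0 : 0 ≤ ω) (hω1 : ω ≤ 1) (hξ : 0 ≤ ξ) (hCf : 0 ≤ Cf) (hCN : 0 ≤ CN)
    (hM : 0 ≤ M) (he8 : 0 ≤ e8) (hsf : sf ≤ ξ * Cf * (nr + 2 * ξ * ny)) (hr : nr ≤ e8 * (ξ * CN * M) + M * S)
    (hy : ny ≤ ξ * CN * M) :
    ω * sf ≤ ξ * Cf * M * (ξ * CN) * e8 + ξ * Cf * M * (S + 2 * ξ ^ 2 * CN) * ω := by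
  have h1 : nr + 2 * ξ * ny ≤ (e8 * (ξ * CN * M) + M * S) + 2 * ξ * (ξ * CN * M) := by
    have := mul_le_mul_of_nonneg_left hy (by positivity : (0:ℝ) ≤ 2 * ξ)
    linarith
  have h2 : sf ≤ ξ * Cf * ((e8 * (ξ * CN * M) + M * S) + 2 * ξ * (ξ * CN * M)) :=
    hsf.trans (mul_le_mul_of_nonneg_left h1 (by positivity))
  have h3 : ω * sf ≤ ω * (ξ * Cf * ((e8 * (ξ * CN * M) + M * S) + 2 * ξ * (ξ * CN * M))) := mul_le_mul_of_nonneg_left h2 hω0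
  have h4 : ω * (ξ * Cf * M * (ξ * CN) * e8) ≤ 1 * (ξ * Cf * M * (ξ * CN) * e8) :=
    mul_le_mul_of_nonneg_right hω1 (by positivity)
  have e : ω * (ξ * Cf * ((e8 * (ξ * CN * M) + M * S) + 2 * ξ * (ξ * CN * M))) =
      ω * (ξ * Cf * M * (ξ * CN) * e8) + ξ * Cf * M * (S + 2 * ξ ^ 2 * CN) * ω := by ring
  linarith

/-- **THE WEIGHTED FORCING BUDGET** (single-mode datum, hypotheses of `residualX_norm_le_single`, `r_lo > 0`): for `t ∈ [0,T]`,
`∫₀ᵗ e^{−r_lo(t−s)}‖slowForcing s‖ds ≤ ξ·Cf·M·(ξ·CN·min(t, 8/(π²lo)) + (√ρ₂ + 2ξ²CN)·min(t, 1/r_lo))`, `Cf = Σⱼ4π‖αⱼ‖`.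
[cite: SandersVerhulstMurdock2007, Lemma 5.2.7 (linear case)] [cite: BedrossianCotiZelati2017, §2] -/
theorem forcing_integral_le_single (W₁ : LatticeWord k₀) {lo hi β : ℝ} (hlo : 0 < lo) (hhi : 0 ≤ hi) (hβ : 0 ≤ β) {n : ℕ} (hn : n ≠ 0)
    {T : ℝ} (hT : 0 < T) {𝔸 : Torus.Visc4 (Fin 3)} (h𝔸 : Torus.NearIso 𝔸 lo hi) (hodd : Torus.OddSmall 𝔸 β)
    {ℓ : Fin 3 → ℤ} (hℓ0 : ℓ ≠ 0) (hℓ : 2 * Real.sqrt (freqNormSq ℓ) < n) {p : EuclideanSpace ℝ (Fin 3)} (hp : ⟪p, Torus.latticeVec ℓ⟫_ℝ = 0)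
    {w : ℝ → UnitAddTorus (Fin 3) → EuclideanSpace ℝ (Fin 3)}
    (h : Torus.IsWeakTensorPassiveVectorOn 0 T ((1 / (n : ℝ) ^ 2) • 𝔸) (W₁.cell n) (fun x => (UnitAddTorus.mFourier ℓ x).re • p) w)
    {R Mm : ℕ} (hR : 1 ≤ R) (hMR : Mm ≤ R) (hM : ∀ j i, |(W₁.phase j).m i| ≤ (Mm : ℤ)) {M : ℝ}
    (hxM : ∀ s ∈ Icc 0 T, ‖modeRep W₁ n ((1 / (n : ℝ) ^ 2) • 𝔸) (fun x => (UnitAddTorus.mFourier ℓ x).re • p) w ℓ s‖ ≤ M)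
    (hE0 : (∫ x, ‖(UnitAddTorus.mFourier ℓ x).re • p‖ ^ 2) ≤ M ^ 2)
    (hsmall : 2 * (12 * (xiCN W₁ lo * xiCf W₁) ^ 2 / (Real.pi ^ 2 * lo)) * (Real.sqrt (freqNormSq ℓ) / n) ^ 4 ≤ Real.pi ^ 2 * lo / 4)
    {rlo : ℝ} (hrlo : 0 < rlo) {t : ℝ} (ht : t ∈ Icc 0 T) :
    ∫ s in (0:ℝ)..t, Real.exp (-(rlo * (t - s))) * ‖slowForcing W₁ n ℓ 𝔸 R (fun x => (UnitAddTorus.mFourier ℓ x).re • p) w s‖ ≤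
      (Real.sqrt (freqNormSq ℓ) / n) * (∑ j, 4 * Real.pi * ‖slotAmp W₁ j‖) * M *
        ((Real.sqrt (freqNormSq ℓ) / n) * xiCN W₁ lo * min t (1 / (Real.pi ^ 2 * lo / 8)) + (Real.sqrt (((Real.sqrt (freqNormSq ℓ) / n) ^ 4 * (xiCN W₁ lo ^ 2 * ((32 * Real.pi ^ 2 * 534 ^ 2 * (hi + β / 2) ^ 2 / lo + 24 * (∑ j, 2 * Real.pi * ‖slotAmp W₁ j‖ * (5 + 3 * Real.sqrt (freqNormSq (W₁.phase j).m))) ^ 2 / (Real.pi ^ 2 * lo)) + 2 * (12 * (xiCN W₁ lo * xiCf W₁) ^ 2 / (Real.pi ^ 2 * lo)) * (Real.sqrt (freqNormSq ℓ) / n) ^ 2) + (6 * (∑ j, 4 * Real.pi * ‖slotAmp W₁ j‖ / Real.sqrt (freqNormSq (W₁.phase j).m)) ^ 2 / (Real.pi ^ 2 * lo) + 12 * (xiCN W₁ lo * (4 * Real.pi ^ 2 * (hi + β / 2))) ^ 2 / (Real.pi ^ 2 * lo))) + 2 / lo * ((4 * k₀ * (∑ j, ‖slotAmp W₁ j‖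 ^ 2) * (k₀ * (∑ j, ‖slotAmp W₁ j‖ ^ 2) * (64 * (∑ j, ‖slotAmp W₁ j‖) ^ 2 / (Real.pi ^ 2 * lo ^ 2)) / (Real.pi ^ 2 * lo ^ 2 * (R : ℝ) ^ 2))) * (Real.sqrt (freqNormSq ℓ) / n) ^ 2)) / (Real.pi ^ 2 * lo / 4)) + 2 * (Real.sqrt (freqNormSq ℓ) / n) ^ 2 * xiCN W₁ lo) * min t (1 / rlo)) := by
  have hn0 : (0 : ℝ) < n := by exact_mod_cast Nat.pos_of_ne_zero hn
  have hξ0 : 0 ≤ (Real.sqrt (freqNormSq ℓ) / n) := by positivity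
  have hCN0 : 0 ≤ xiCN W₁ lo := xiCN_nonneg W₁ hlo
  have hCf0 : 0 ≤ (∑ j, 4 * Real.pi * ‖slotAmp W₁ j‖) := Finset.sum_nonneg fun j _ => by positivity
  have hM0 : 0 ≤ M := (norm_nonneg _).trans (hxM 0 ⟨le_rfl, hT.le⟩)
  have hσ8 : 0 < Real.pi ^ 2 * lo / 8 := by positivity
  have hS0 : 0 ≤ Real.sqrt (((Real.sqrt (freqNormSq ℓ) / n) ^ 4 * (xiCN W₁ lo ^ 2 * ((32 * Real.pi ^ 2 * 534 ^ 2 * (hi + β / 2) ^ 2 / lo + 24 * (∑ j, 2 * Real.pi * ‖slotAmp W₁ j‖ * (5 + 3 * Real.sqrt (freqNormSq (W₁.phase j).m))) ^ 2 / (Real.pi ^ 2 * lo)) + 2 * (12 * (xiCN W₁ lo * xiCf W₁) ^ 2 / (Real.pi ^ 2 * lo)) * (Real.sqrt (freqNormSq ℓ) / n) ^ 2) + (6 * (∑ j, 4 * Real.pi * ‖slotAmp W₁ j‖ / Real.sqrt (freqNormSq (W₁.phase j).m)) ^ 2 / (Real.pi ^ 2 * lo) + 12 * (xiCN W₁ lo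 * (4 * Real.pi ^ 2 * (hi + β / 2))) ^ 2 / (Real.pi ^ 2 * lo))) + 2 / lo * ((4 * k₀ * (∑ j, ‖slotAmp W₁ j‖ ^ 2) * (k₀ * (∑ j, ‖slotAmp W₁ j‖ ^ 2) * (64 * (∑ j, ‖slotAmp W₁ j‖) ^ 2 / (Real.pi ^ 2 * lo ^ 2)) / (Real.pi ^ 2 * lo ^ 2 * (R : ℝ) ^ 2))) * (Real.sqrt (freqNormSq ℓ) / n) ^ 2)) / (Real.pi ^ 2 * lo / 4)) := Real.sqrt_nonneg _
  -- pointwise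
  have hpt : ∀ s ∈ Icc 0 t, Real.exp (-(rlo * (t - s))) * ‖slowForcing W₁ n ℓ 𝔸 R (fun x => (UnitAddTorus.mFourier ℓ x).re • p) w s‖ ≤
      (Real.sqrt (freqNormSq ℓ) / n) * (∑ j, 4 * Real.pi * ‖slotAmp W₁ j‖) * M * ((Real.sqrt (freqNormSq ℓ) / n) * xiCN W₁ lo) * Real.exp (-(Real.pi ^ 2 * lo / 8 * s)) +
        (Real.sqrt (freqNormSq ℓ) / n) * (∑ j, 4 * Real.pi * ‖slotAmp W₁ j‖) * M * (Real.sqrt (((Real.sqrt (freqNormSq ℓ) / n) ^ 4 * (xiCN W₁ lo ^ 2 * ((32 * Real.pi ^ 2 * 534 ^ 2 * (hi + β / 2) ^ 2 / lo + 24 * (∑ j, 2 * Real.pi * ‖slotAmp W₁ j‖ * (5 + 3 * Real.sqrt (freqNormSq (W₁.phase j).m))) ^ 2 / (Real.pi ^ 2 * lo)) + 2 * (12 * (xiCN W₁ lo * xiCf W₁) ^ 2 / (Real.pi ^ 2 * lo)) * (Real.sqrt (freqNormSq ℓ) / n) ^ 2) + (6 * (∑ j, 4 * Real.pi * ‖slotAmp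 W₁ j‖ / Real.sqrt (freqNormSq (W₁.phase j).m)) ^ 2 / (Real.pi ^ 2 * lo) + 12 * (xiCN W₁ lo * (4 * Real.pi ^ 2 * (hi + β / 2))) ^ 2 / (Real.pi ^ 2 * lo))) + 2 / lo * ((4 * k₀ * (∑ j, ‖slotAmp W₁ j‖ ^ 2) * (k₀ * (∑ j, ‖slotAmp W₁ j‖ ^ 2) * (64 * (∑ j, ‖slotAmp W₁ j‖) ^ 2 / (Real.pi ^ 2 * lo ^ 2)) / (Real.pi ^ 2 * lo ^ 2 * (R : ℝ) ^ 2))) * (Real.sqrt (freqNormSq ℓ) / n) ^ 2)) / (Real.pi ^ 2 * lo / 4)) + 2 * (Real.sqrt (freqNormSq ℓ) / n) ^ 2 * xiCN W₁ lo) * Real.exp (-(rlo * (t - s))) := by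
    intro s hs
    have hsT : s ∈ Icc 0 T := ⟨hs.1, hs.2.trans ht.2⟩
    have hr := residualX_norm_le_single W₁ hlo hhi hβ hn hT h𝔸 hodd hℓ0 hℓ hp h hR hMR hM hxM hE0 hsmall hsT
    have hy : ‖refState W₁ n ℓ 𝔸 R (fun x => (UnitAddTorus.mFourier ℓ x).re • p) w s‖ ≤ (Real.sqrt (freqNormSq ℓ) / n) * xiCN W₁ lo * M := by
      have h1 := norm_refState_le W₁ n ℓ h𝔸 hlo R (fun x => (UnitAddTorus.mFourier ℓ x).re • p) w s
      rw [← xiCN_def] at h1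
      exact h1.trans (mul_le_mul_of_nonneg_left (hxM s hsT) (by positivity))
    have hsf := norm_slowForcing_le W₁ hn hℓ.le h𝔸 hlo R (fun x => (UnitAddTorus.mFourier ℓ x).re • p) w s
    have hω1 : Real.exp (-(rlo * (t - s))) ≤ 1 := by rw [Real.exp_le_one_iff]; nlinarith [hs.2, hrlo]
    exact budget_pointwise (Real.exp_pos _).le hω1 hξ0 hCf0 hCN0 hM0 (Real.exp_pos _).le hsf hr hy
  -- integrate
  have hcontSF : ContinuousOn (fun s => Real.exp (-(rlo * (t - s))) * ‖slowForcing W₁ n ℓ 𝔸 R (fun x => (UnitAddTorus.mFourier ℓ x).re • p) w s‖) (Icc 0 t) :=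
    ((continuous_const.mul (continuous_const.sub continuous_id)).neg.rexp.continuousOn).mul
      (((continuousOn_slowForcing W₁ ℓ h𝔸 hlo R hT.le h).mono (Icc_subset_Icc_right ht.2)).norm)
  have hi1 := hcontSF.intervalIntegrable_of_Icc (μ := volume) ht.1
  have hc8 : Continuous fun s : ℝ => Real.exp (-(Real.pi ^ 2 * lo / 8 * s)) := (continuous_const.mul continuous_id).neg.rexp
  have hcw : Continuous fun s : ℝ => Real.exp (-(rlo * (t - s))) := (continuous_const.mul (continuous_const.sub continuous_id)).neg.rexp
  have hiA : IntervalIntegrable (fun s => (Real.sqrt (freqNormSq ℓ) / n) * (∑ j, 4 * Real.pi * ‖slotAmp W₁ j‖) * M * ((Real.sqrt (freqNormSq ℓ) / n) * xiCN W₁ lo) * Real.exp (-(Real.pi ^ 2 * lo / 8 * s))) volume 0 t :=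
    (continuous_const.mul hc8).intervalIntegrable 0 t
  have hiB : IntervalIntegrable (fun s => (Real.sqrt (freqNormSq ℓ) / n) * (∑ j, 4 * Real.pi * ‖slotAmp W₁ j‖) * M * (Real.sqrt (((Real.sqrt (freqNormSq ℓ) / n) ^ 4 * (xiCN W₁ lo ^ 2 * ((32 * Real.pi ^ 2 * 534 ^ 2 * (hi + β / 2) ^ 2 / lo + 24 * (∑ j, 2 * Real.pi * ‖slotAmp W₁ j‖ * (5 + 3 * Real.sqrt (freqNormSq (W₁.phase j).m))) ^ 2 / (Real.pi ^ 2 * lo)) + 2 * (12 * (xiCN W₁ lo * xiCf W₁) ^ 2 / (Real.pi ^ 2 * lo)) * (Real.sqrt (freqNormSq ℓ) / n) ^ 2) + (6 * (∑ j, 4 * Real.pi * ‖slotAmp W₁ j‖ / Real.sqrt (freqNormSq (W₁.phase j).m)) ^ 2 / (Real.pi ^ 2 * lo) + 12 * (xiCN W₁ lo * (4 * Real.pi ^ 2 * (hi + β / 2))) ^ 2 / (Real.pi ^ 2 * lo))) + 2 / lo * ((4 * k₀ * (∑ j, ‖slotAmp W₁ j‖ ^ 2) * (k₀ * (∑ j,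 ‖slotAmp W₁ j‖ ^ 2) * (64 * (∑ j, ‖slotAmp W₁ j‖) ^ 2 / (Real.pi ^ 2 * lo ^ 2)) / (Real.pi ^ 2 * lo ^ 2 * (R : ℝ) ^ 2))) * (Real.sqrt (freqNormSq ℓ) / n) ^ 2)) / (Real.pi ^ 2 * lo / 4)) + 2 * (Real.sqrt (freqNormSq ℓ) / n) ^ 2 * xiCN W₁ lo) * Real.exp (-(rlo * (t - s))))
      volume 0 t := (continuous_const.mul hcw).intervalIntegrable 0 t
  have hA0 : 0 ≤ (Real.sqrt (freqNormSq ℓ) / n) * (∑ j, 4 * Real.pi * ‖slotAmp W₁ j‖) * M * ((Real.sqrt (freqNormSq ℓ) / n) * xiCN W₁ lo) := by positivity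
  have hB0 : 0 ≤ (Real.sqrt (freqNormSq ℓ) / n) * (∑ j, 4 * Real.pi * ‖slotAmp W₁ j‖) * M * (Real.sqrt (((Real.sqrt (freqNormSq ℓ) / n) ^ 4 * (xiCN W₁ lo ^ 2 * ((32 * Real.pi ^ 2 * 534 ^ 2 * (hi + β / 2) ^ 2 / lo + 24 * (∑ j, 2 * Real.pi * ‖slotAmp W₁ j‖ * (5 + 3 * Real.sqrt (freqNormSq (W₁.phase j).m))) ^ 2 / (Real.pi ^ 2 * lo)) + 2 * (12 * (xiCN W₁ lo * xiCf W₁) ^ 2 / (Real.pi ^ 2 * lo)) * (Real.sqrt (freqNormSq ℓ) / n) ^ 2) + (6 * (∑ j, 4 * Real.pi * ‖slotAmp W₁ j‖ / Real.sqrt (freqNormSq (W₁.phase j).m)) ^ 2 / (Real.pi ^ 2 * lo) + 12 * (xiCN W₁ lo * (4 * Real.pi ^ 2 * (hi + β / 2))) ^ 2 / (Real.pi ^ 2 * lo))) + 2 / lo * ((4 * k₀ * (∑ j, ‖slotAmp W₁ j‖ ^ 2) * (k₀ * (∑ j, ‖slotAmp W₁ j‖ ^ 2) * (64 * (∑ j,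 ‖slotAmp W₁ j‖) ^ 2 / (Real.pi ^ 2 * lo ^ 2)) / (Real.pi ^ 2 * lo ^ 2 * (R : ℝ) ^ 2))) * (Real.sqrt (freqNormSq ℓ) / n) ^ 2)) / (Real.pi ^ 2 * lo / 4)) + 2 * (Real.sqrt (freqNormSq ℓ) / n) ^ 2 * xiCN W₁ lo) := by positivity
  calc _ ≤ ∫ s in (0:ℝ)..t, ((Real.sqrt (freqNormSq ℓ) / n) * (∑ j, 4 * Real.pi * ‖slotAmp W₁ j‖) * M * ((Real.sqrt (freqNormSq ℓ) / n) * xiCN W₁ lo) * Real.exp (-(Real.pi ^ 2 * lo / 8 * s)) +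
        (Real.sqrt (freqNormSq ℓ) / n) * (∑ j, 4 * Real.pi * ‖slotAmp W₁ j‖) * M * (Real.sqrt (((Real.sqrt (freqNormSq ℓ) / n) ^ 4 * (xiCN W₁ lo ^ 2 * ((32 * Real.pi ^ 2 * 534 ^ 2 * (hi + β / 2) ^ 2 / lo + 24 * (∑ j, 2 * Real.pi * ‖slotAmp W₁ j‖ * (5 + 3 * Real.sqrt (freqNormSq (W₁.phase j).m))) ^ 2 / (Real.pi ^ 2 * lo)) + 2 * (12 * (xiCN W₁ lo * xiCf W₁) ^ 2 / (Real.pi ^ 2 * lo)) * (Real.sqrt (freqNormSq ℓ) / n) ^ 2) + (6 * (∑ j, 4 * Real.pi * ‖slotAmp W₁ j‖ / Real.sqrt (freqNormSq (W₁.phase j).m)) ^ 2 / (Real.pi ^ 2 * lo) + 12 * (xiCN W₁ lo * (4 * Real.pi ^ 2 * (hi + β / 2))) ^ 2 / (Real.pi ^ 2 * lo))) + 2 / lo * ((4 * k₀ * (∑ j, ‖slotAmp W₁ j‖ ^ 2) * (k₀ * (∑ j, ‖slotAmp W₁ j‖ ^ 2) * (64 * (∑ j, ‖slotAmp W₁ j‖)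 ^ 2 / (Real.pi ^ 2 * lo ^ 2)) / (Real.pi ^ 2 * lo ^ 2 * (R : ℝ) ^ 2))) * (Real.sqrt (freqNormSq ℓ) / n) ^ 2)) / (Real.pi ^ 2 * lo / 4)) + 2 * (Real.sqrt (freqNormSq ℓ) / n) ^ 2 * xiCN W₁ lo) * Real.exp (-(rlo * (t - s)))) :=
        intervalIntegral.integral_mono_on ht.1 hi1 (hiA.add hiB) hpt
    _ = (Real.sqrt (freqNormSq ℓ) / n) * (∑ j, 4 * Real.pi * ‖slotAmp W₁ j‖) * M * ((Real.sqrt (freqNormSq ℓ) / n) * xiCN W₁ lo) * (∫ s in (0:ℝ)..t, Real.exp (-(Real.pi ^ 2 * lo / 8 * s))) +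
        (Real.sqrt (freqNormSq ℓ) / n) * (∑ j, 4 * Real.pi * ‖slotAmp W₁ j‖) * M * (Real.sqrt (((Real.sqrt (freqNormSq ℓ) / n) ^ 4 * (xiCN W₁ lo ^ 2 * ((32 * Real.pi ^ 2 * 534 ^ 2 * (hi + β / 2) ^ 2 / lo + 24 * (∑ j, 2 * Real.pi * ‖slotAmp W₁ j‖ * (5 + 3 * Real.sqrt (freqNormSq (W₁.phase j).m))) ^ 2 / (Real.pi ^ 2 * lo)) + 2 * (12 * (xiCN W₁ lo * xiCf W₁) ^ 2 / (Real.pi ^ 2 * lo)) * (Real.sqrt (freqNormSq ℓ) / n) ^ 2) + (6 * (∑ j, 4 * Real.pi * ‖slotAmp W₁ j‖ / Real.sqrt (freqNormSq (W₁.phase j).m)) ^ 2 / (Real.pi ^ 2 * lo) + 12 * (xiCN W₁ lo * (4 * Real.pi ^ 2 * (hi + β / 2))) ^ 2 / (Real.pi ^ 2 * lo))) + 2 / lo * ((4 * k₀ * (∑ j, ‖slotAmp W₁ j‖ ^ 2) * (k₀ * (∑ j, ‖slotAmp W₁ j‖ ^ 2) * (64 * (∑ j, ‖slotAmp W₁ j‖)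 ^ 2 / (Real.pi ^ 2 * lo ^ 2)) / (Real.pi ^ 2 * lo ^ 2 * (R : ℝ) ^ 2))) * (Real.sqrt (freqNormSq ℓ) / n) ^ 2)) / (Real.pi ^ 2 * lo / 4)) + 2 * (Real.sqrt (freqNormSq ℓ) / n) ^ 2 * xiCN W₁ lo) * (∫ s in (0:ℝ)..t, Real.exp (-(rlo * (t - s)))) := by
        rw [intervalIntegral.integral_add hiA hiB, intervalIntegral.integral_const_mul, intervalIntegral.integral_const_mul]
    _ ≤ (Real.sqrt (freqNormSq ℓ) / n) * (∑ j, 4 * Real.pi * ‖slotAmp W₁ j‖) * M * ((Real.sqrt (freqNormSq ℓ) / n) * xiCN W₁ lo) * min t (1 / (Real.pi ^ 2 * lo / 8)) +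
        (Real.sqrt (freqNormSq ℓ) / n) * (∑ j, 4 * Real.pi * ‖slotAmp W₁ j‖) * M * (Real.sqrt (((Real.sqrt (freqNormSq ℓ) / n) ^ 4 * (xiCN W₁ lo ^ 2 * ((32 * Real.pi ^ 2 * 534 ^ 2 * (hi + β / 2) ^ 2 / lo + 24 * (∑ j, 2 * Real.pi * ‖slotAmp W₁ j‖ * (5 + 3 * Real.sqrt (freqNormSq (W₁.phase j).m))) ^ 2 / (Real.pi ^ 2 * lo)) + 2 * (12 * (xiCN W₁ lo * xiCf W₁) ^ 2 / (Real.pi ^ 2 * lo)) * (Real.sqrt (freqNormSq ℓ) / n) ^ 2) + (6 * (∑ j, 4 * Real.pi * ‖slotAmp W₁ j‖ / Real.sqrt (freqNormSq (W₁.phase j).m)) ^ 2 / (Real.pi ^ 2 * lo) + 12 * (xiCN W₁ lo * (4 * Real.pi ^ 2 * (hi + β / 2))) ^ 2 / (Real.pi ^ 2 * lo))) + 2 / lo * ((4 * k₀ * (∑ j, ‖slotAmp W₁ j‖ ^ 2) * (k₀ * (∑ j, ‖slotAmp W₁ j‖ ^ 2) * (64 * (∑ j, ‖slotAmp W₁ j‖)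 ^ 2 / (Real.pi ^ 2 * lo ^ 2)) / (Real.pi ^ 2 * lo ^ 2 * (R : ℝ) ^ 2))) * (Real.sqrt (freqNormSq ℓ) / n) ^ 2)) / (Real.pi ^ 2 * lo / 4)) + 2 * (Real.sqrt (freqNormSq ℓ) / n) ^ 2 * xiCN W₁ lo) * min t (1 / rlo) :=
        add_le_add (mul_le_mul_of_nonneg_left (integral_exp_neg_le_min hσ8 ht.1) hA0)
          (mul_le_mul_of_nonneg_left (integral_exp_neg_sub_le_min' hrlo ht.1) hB0)
    _ = _ := by ring

end Summit.AnomalousDissipation.AnomalousDissipation.Theorems.SolenoidalFractalHomogenisation.LagrangianStep.Sideband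

end
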